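import Mathlib
import HarnessLib
import Summits.HubbardSuperconductivity.HubbardSuperconductivity.Theorems.KLProgrammeKLRegimeEngineTowerModelDefs
import Summits.HubbardSuperconductivity.HubbardSuperconductivity.Theorems.KLProgrammeKLRegimeEngineV8TwoLegGridMomentsTelescope

/-!
# Route `KLProgramme` — crux K3 ENGINE (stmt-HubbardSuperconductivity-20437 `KLRegimeEngineV17F2`), stub (b) v2, THE LEVELS PACKAGE (ℓ):
# MODEL TOWER DATA, RATE-DECOUPLED — the weighted currency with the family index and the weight RATE index separated
# (E1-LEVELS-BLUEPRINT-g8 §2 / (I1′); E1 lead r2d-p2 g8; answer to k3c3-p2 g10 «(b)-Wt-FAMILY-DEEP», KL STATUS 2026-08-27T22:11Z)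

`…EngineTowerModelDefs` (p574949) ties the tree-weight rate of the weighted pinned sums to the sector family: `klWtPinnedSumOf … J` carries `klScaleWt … J` (rate
`Λ_J`).  The blocked tower is run ONCE PER READ-OUT LEVEL `j` (blueprint §2) and conjunct 2 at level `j` reads the weight `klScaleWt … j` (rate `Λ_j ≤ Λ_J` at every
internal level `J ≤ j`); the block-step doors (`…EngineTowerBlockStepWt`, p576556) take the tree weight as a free parameter.  Reading EVERY internal row, overlap and
born size of the run at the TARGET rate `Λ_j` makes the suppliers' weighted constants n-free at all internal levels (k3c3-p2's «(K4) reading»: `(n−2J)/3 ≤ n−J`),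
so the carriers need the rate index decoupled from the family index:

* §1 **`klWtPinnedSumAt L M β μ K J j m T q w`** — family `F_J`, weight `klScaleWt … j`; `klWtPinnedSumAt_self` (`j = J` is `klWtPinnedSumOf`, `rfl`), nonnegativity,
  `klWtPinnedSumAt_sum_le` / `_add_le` (subadditivity), **`klWtPinnedSumAt_anti_rate`** (`J ≤ j ⇒` the rate-`j` sum is at most the rate-`J` one: `klScaleWt` is antitone
  in its index, `klScaleWt_le_of_le`);
* §2 the rate-decoupled arrays **`klTowerBornWtAt … d k j m`** (born `Δ_k` at family `F_{dk}`, rate `j`) and **`klTowerMeasWtAt … d k j m`** (input `𝒱_{dk}` at `F_{dk−1}`,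
  rate `j`) with the `le_ciSup` rows, nonnegativity, and the comparison with the tied arrays (`klTowerBornWtAt_le_klTowerBornWt` for `dk ≤ j`).
Definitions with bodies + order rows; nothing about the model is asserted; nothing asserts superconductivity.
-/

noncomputable section

namespace Summit.HubbardSuperconductivity.HubbardSuperconductivity.Theorems.EngineV8

set_option linter.dupNamespace false -- summit = problem name (single-conjunct summit), D-0017

open Real Finset Literature.MathematicalPhysics.QuantumLattice Literature.Probability.LatticeModels
open Literature.MathematicalPhysics.QuantumLattice.FermiRG
open Summit.HubbardSuperconductivity.HubbardSuperconductivity.Theorems.KLRegimeSplit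
open Summit.HubbardSuperconductivity.HubbardSuperconductivity.Theorems.KLProgrammeLegKernels
open Summit.HubbardSuperconductivity.HubbardSuperconductivity.Theorems.DispersionFlow

variable {L M : ℕ}

/-- **`klScaleWt` is antitone in its index**: `a ≤ b ⇒ klScaleWt … b S ≤ klScaleWt … a S` (the rate `Λ_n` decreases with `n`). -/
theorem klScaleWt_le_of_le (β : ℝ) {a b : ℕ} (hab : a ≤ b) (S : Finset (ZMod (2 * (2 * M)) × TorusSite 2 L)) :
    klScaleWt L M β b S ≤ klScaleWt L M β a S := by
  induction hab with
  | refl => exact le_rfl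
  | step _ ih => exact (klScaleWt_succ_le β _ S).trans ih

variable (L M) [NeZero L]

/-! ## §1 The rate-decoupled weighted pinned sum -/

/-- **`klWtPinnedSumAt L M β μ K J j m T q w`** — the weighted pinned sum of the degree-`m` kernel of `map (toLin' E(F_J)) T` (family `F_J = klAnisoFamily … K klE0 J`),
leg `q` pinned at `w`, with the tree weight `klScaleWt L M β j` of RATE index `j` (independent of `J`). -/
def klWtPinnedSumAt (β μ : ℝ) (K : TrigPolyC4v) (J j m : ℕ) (T : HubbardGrassmann L M) (q : Fin m)
    (w : SpaceTimeIdx L M × SectorLeg (sectorCount J)) : ℝ :=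
  imagTimeWeight β M ^ (m - 1) *
    ∑ X ∈ univ.filter (fun X : Fin m → SpaceTimeIdx L M × SectorLeg (sectorCount J) => X q = w),
      klScaleWt L M β j ((univ.image X).image (latticeLegPos (2 * (2 * M)))) *
        ‖kernel ℂ (ExteriorAlgebra.map (Matrix.toLin' (sectorAnalysisMatrix L M β (klAnisoFamily L M β μ K klE0 J))) T) m X‖

variable {L M}

/-- At rate index `j = J` the decoupled sum IS `klWtPinnedSumOf` (`rfl`). -/
theorem klWtPinnedSumAt_self (β μ : ℝ) (K : TrigPolyC4v) (J m : ℕ) (T : HubbardGrassmann L M) (q : Fin m)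
    (w : SpaceTimeIdx L M × SectorLeg (sectorCount J)) :
    klWtPinnedSumAt L M β μ K J J m T q w = klWtPinnedSumOf L M β μ K J m T q w := rfl

/-- The decoupled sum in degree `m + 1`, with the `ε`-power written as `m` (`rfl`). -/
theorem klWtPinnedSumAt_succ (β μ : ℝ) (K : TrigPolyC4v) (J j m : ℕ) (T : HubbardGrassmann L M) (q : Fin (m + 1))
    (w : SpaceTimeIdx L M × SectorLeg (sectorCount J)) :
    klWtPinnedSumAt L M β μ K J j (m + 1) T q w = imagTimeWeight β M ^ m *
      ∑ X ∈ univ.filter (fun X : Fin (m + 1) → SpaceTimeIdx L M × SectorLeg (sectorCount J) => X q = w),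
        klScaleWt L M β j ((univ.image X).image (latticeLegPos (2 * (2 * M)))) *
          ‖kernel ℂ (ExteriorAlgebra.map (Matrix.toLin' (sectorAnalysisMatrix L M β (klAnisoFamily L M β μ K klE0 J))) T) (m + 1) X‖ := rfl

/-- Nonnegativity (`0 ≤ β`). -/
theorem klWtPinnedSumAt_nonneg {β : ℝ} (hβ : 0 ≤ β) (μ : ℝ) (K : TrigPolyC4v) (J j m : ℕ) (T : HubbardGrassmann L M) (q : Fin m)
    (w : SpaceTimeIdx L M × SectorLeg (sectorCount J)) : 0 ≤ klWtPinnedSumAt L M β μ K J j m T q w :=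
  mul_nonneg (pow_nonneg (imagTimeWeight_nonneg hβ M) _)
    (sum_nonneg fun _ _ => mul_nonneg (zero_le_one.trans (one_le_klScaleWt L M β j _)) (norm_nonneg _))

/-- **Subadditivity**: the decoupled sum of a finite sum of Grassmann elements is at most the sum of theirs. -/
theorem klWtPinnedSumAt_sum_le {β : ℝ} (hβ : 0 ≤ β) (μ : ℝ) (K : TrigPolyC4v) (J j m : ℕ) {ι : Type*} (s : Finset ι)
    (T : ι → HubbardGrassmann L M) (q : Fin m) (w : SpaceTimeIdx L M × SectorLeg (sectorCount J)) :
    klWtPinnedSumAt L M β μ K J j m (∑ i ∈ s, T i) q w ≤ ∑ i ∈ s, klWtPinnedSumAt L M β μ K J j m (T i) q w := by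
  unfold klWtPinnedSumAt
  rw [← mul_sum, sum_comm]
  refine mul_le_mul_of_nonneg_left (sum_le_sum fun X _ => ?_) (pow_nonneg (imagTimeWeight_nonneg hβ M) _)
  rw [← mul_sum]
  refine mul_le_mul_of_nonneg_left ?_ (zero_le_one.trans (one_le_klScaleWt L M β j _))
  rw [map_sum, kernel_sum]
  exact norm_sum_le _ _

/-- Two summands. -/
theorem klWtPinnedSumAt_add_le {β : ℝ} (hβ : 0 ≤ β) (μ : ℝ) (K : TrigPolyC4v) (J j m : ℕ) (A B : HubbardGrassmann L M) (q : Fin m)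
    (w : SpaceTimeIdx L M × SectorLeg (sectorCount J)) :
    klWtPinnedSumAt L M β μ K J j m (A + B) q w ≤ klWtPinnedSumAt L M β μ K J j m A q w + klWtPinnedSumAt L M β μ K J j m B q w := by
  have h := klWtPinnedSumAt_sum_le hβ μ K J j m (univ : Finset (Fin 2)) ![A, B] q w
  simpa [Fin.sum_univ_two] using h

/-- **Antitone in the rate index**: `j ≤ j′ ⇒` the rate-`j′` sum is at most the rate-`j` sum (in particular the target-rate sum, `j′ = ` the read-out level, is at most
the family-rate sum, `j = J`). -/
theorem klWtPinnedSumAt_anti_rate {β : ℝ} (hβ : 0 ≤ β) (μ : ℝ) (K : TrigPolyC4v) (J : ℕ) {j j' : ℕ} (hjj : j ≤ j') (m : ℕ) (T : HubbardGrassmann L M)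
    (q : Fin m) (w : SpaceTimeIdx L M × SectorLeg (sectorCount J)) :
    klWtPinnedSumAt L M β μ K J j' m T q w ≤ klWtPinnedSumAt L M β μ K J j m T q w := by
  unfold klWtPinnedSumAt
  refine mul_le_mul_of_nonneg_left (sum_le_sum fun X _ => ?_) (pow_nonneg (imagTimeWeight_nonneg hβ M) _)
  exact mul_le_mul_of_nonneg_right (klScaleWt_le_of_le β hjj _) (norm_nonneg _)

/-- The target-rate sum at a read-out level `j ≥ J` is at most the tied sum `klWtPinnedSumOf … J`. -/
theorem klWtPinnedSumAt_le_klWtPinnedSumOf {β : ℝ} (hβ : 0 ≤ β) (μ : ℝ) (K : TrigPolyC4v) {J j : ℕ} (hJj : J ≤ j) (m : ℕ) (T : HubbardGrassmann L M)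
    (q : Fin m) (w : SpaceTimeIdx L M × SectorLeg (sectorCount J)) :
    klWtPinnedSumAt L M β μ K J j m T q w ≤ klWtPinnedSumOf L M β μ K J m T q w :=
  klWtPinnedSumAt_anti_rate hβ μ K J hJj m T q w

variable (L M)

/-! ## §2 The rate-decoupled size arrays -/

/-- **`klTowerBornWtAt L M β U μ K d k j m`** — born weighted size of block `k` in degree `m` at RATE index `j`: the supremum over pins of the rate-`j` weighted pinned
sums of `Δ_k` at its born family `F_{dk}`. -/
def klTowerBornWtAt (β U μ : ℝ) (K : TrigPolyC4v) (d k j m : ℕ) : ℝ :=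
  ⨆ qw : Fin m × (SpaceTimeIdx L M × SectorLeg (sectorCount (d * k))),
    klWtPinnedSumAt L M β μ K (d * k) j m (klTowerIncr L M β U μ K d k) qw.1 qw.2

/-- **`klTowerMeasWtAt L M β U μ K d k j m`** — measured weighted size of the input `𝒱_{dk}` of block `k` at `F_{dk−1}`, rate index `j`. -/
def klTowerMeasWtAt (β U μ : ℝ) (K : TrigPolyC4v) (d k j m : ℕ) : ℝ :=
  ⨆ qw : Fin m × (SpaceTimeIdx L M × SectorLeg (sectorCount (d * k - 1))),
    klWtPinnedSumAt L M β μ K (d * k - 1) j m (klTowerInput L M β U μ K d k) qw.1 qw.2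

variable {L M}

/-- Every rate-`j` weighted pinned sum of `Δ_k` at `F_{dk}` is at most the born size at rate `j`. -/
theorem klWtPinnedSumAt_le_klTowerBornWtAt (β U μ : ℝ) (K : TrigPolyC4v) (d k j m : ℕ) (q : Fin m)
    (w : SpaceTimeIdx L M × SectorLeg (sectorCount (d * k))) :
    klWtPinnedSumAt L M β μ K (d * k) j m (klTowerIncr L M β U μ K d k) q w ≤ klTowerBornWtAt L M β U μ K d k j m :=
  le_ciSup (f := fun qw : Fin m × (SpaceTimeIdx L M × SectorLeg (sectorCount (d * k))) =>
    klWtPinnedSumAt L M β μ K (d * k) j m (klTowerIncr L M β U μ K d k) qw.1 qw.2) (Set.finite_range _).bddAbove (q, w)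

/-- Every rate-`j` weighted pinned sum of the input `𝒱_{dk}` at `F_{dk−1}` is at most the measured size at rate `j`. -/
theorem klWtPinnedSumAt_le_klTowerMeasWtAt (β U μ : ℝ) (K : TrigPolyC4v) (d k j m : ℕ) (q : Fin m)
    (w : SpaceTimeIdx L M × SectorLeg (sectorCount (d * k - 1))) :
    klWtPinnedSumAt L M β μ K (d * k - 1) j m (klTowerInput L M β U μ K d k) q w ≤ klTowerMeasWtAt L M β U μ K d k j m :=
  le_ciSup (f := fun qw : Fin m × (SpaceTimeIdx L M × SectorLeg (sectorCount (d * k - 1))) =>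
    klWtPinnedSumAt L M β μ K (d * k - 1) j m (klTowerInput L M β U μ K d k) qw.1 qw.2) (Set.finite_range _).bddAbove (q, w)

/-- Nonnegativity of the born size at rate `j` (`0 ≤ β`). -/
theorem klTowerBornWtAt_nonneg {β : ℝ} (hβ : 0 ≤ β) (U μ : ℝ) (K : TrigPolyC4v) (d k j m : ℕ) : 0 ≤ klTowerBornWtAt L M β U μ K d k j m := by
  unfold klTowerBornWtAt
  rcases isEmpty_or_nonempty (Fin m × (SpaceTimeIdx L M × SectorLeg (sectorCount (d * k)))) with h | h
  · rw [Real.iSup_of_isEmpty]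
  · exact le_ciSup_of_le (Set.finite_range _).bddAbove (Classical.arbitrary _) (klWtPinnedSumAt_nonneg hβ μ K _ j m _ _ _)

/-- **The target-rate born size is at most the tied born size** (`dk ≤ j`): `klTowerBornWtAt … d k j m ≤ klTowerBornWt … d k m`. -/
theorem klTowerBornWtAt_le_klTowerBornWt {β : ℝ} (hβ : 0 ≤ β) (U μ : ℝ) (K : TrigPolyC4v) {d k j : ℕ} (hj : d * k ≤ j) (m : ℕ) :
    klTowerBornWtAt L M β U μ K d k j m ≤ klTowerBornWt L M β U μ K d k m := by
  unfold klTowerBornWtAt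
  rcases isEmpty_or_nonempty (Fin m × (SpaceTimeIdx L M × SectorLeg (sectorCount (d * k)))) with h | h
  · rw [Real.iSup_of_isEmpty]; exact klTowerBornWt_nonneg hβ U μ K d k m
  · exact ciSup_le fun qw => (klWtPinnedSumAt_le_klWtPinnedSumOf hβ μ K hj m _ qw.1 qw.2).trans
      (klWtPinnedSumOf_le_klTowerBornWt β U μ K d k m qw.1 qw.2)

end Summit.HubbardSuperconductivity.HubbardSuperconductivity.Theorems.EngineV8

end
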